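import Summits.QuantumFields.QCD.Theorems.RobustYangMillsRG.Negative.WildBlockingRest
import Summits.QuantumFields.QCD.Theorems.RobustYangMillsRG.Negative.SmallRoots
import HarnessLib

/-!
# `RobustYangMillsRG` — negative side, part C₆: every fibre of the wild blocking map contains
# configurations of arbitrarily small Wilson action — the fibre infimum is identically zero

Support for the disproof of the crux `RobustYangMillsRG` (stmt-QuantumFields-14958): the second
"wild" property (W2). Given a coarse configuration `V`, `n₀ ≥ 1` and `w`, the REALISATION
`realise V n₀ w` is the fine configuration equal to `1` on every link except the private first
links of the lasso plaquettes: the `X`-slot of the coarse edge `c` carries a small `n₀`-th root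
`X_c` of `V c` modulo the centre (`exists_small_root`, `‖X_c − 1‖ ≤ 2π/n₀`), the dial slot carries
`dial (1/(q_c+1))`, `q_c = Nat.pair n₀ (j_c + 3w)`. Then `Bl (realise V n₀ w) = V`
(`bl_realise`), every link is within `max(2π/n₀, 1/(3w+1))` of `1`, so the Wilson action is
`≤ 12 · #plaquettes · max(…)` (`wilsonAction_realise_le`), whence
`⨅_{Bl U = V} S_W(U) = 0` for EVERY `V` (`iInf_fibre_wilsonAction_eq_zero`): the background-field
principal part of the crux's Bałaban format vanishes identically for this admissible blocking map.
Hypotheses: `M b ≤ N`, `20 ≤ b`. [folklore]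
-/

noncomputable section

namespace Summit.QuantumFields.QCD.Theorems.RobustYangMillsRG.Negative

open MeasureTheory Complex Literature.MathematicalPhysics.QuantumFieldTheory Literature.MathematicalPhysics.QuantumLattice
open Literature.MathematicalPhysics.QuantumFieldTheory.WilsonLoopRP (lineHolonomy_congr)
open Literature.Barriers.QuantumFields (scalarCenter)
open scoped Real Matrix.Norms.L2Operator

variable {N M b : ℕ}

/-! ### Small data: roots and dials -/

/-- `ζ` of part B₁ is the centre element used in `exists_small_root`. [folklore] -/
theorem ζ_eq_scalarCenter : (ζ : SU3) = scalarCenter 3 (Complex.exp (2 * π * I / 3))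
    (Complex.isPrimitiveRoot_exp 3 (by norm_num)).pow_eq_one (by norm_num) := rfl

/-- A small `n₀`-th root of `V c` modulo the centre (choice). [folklore] -/
def rootX (V : GaugeConfig 4 M SU3) (n₀ : ℕ) (hn : 1 ≤ n₀) (c : Edge 4 M) : SU3 :=
  (exists_small_root (V c) hn).choose

/-- Its centre power. [folklore] -/
def rootJ (V : GaugeConfig 4 M SU3) (n₀ : ℕ) (hn : 1 ≤ n₀) (c : Edge 4 M) : ℕ :=
  (exists_small_root (V c) hn).choose_spec.choose

/-- `rootJ_lt` (bookkeeping lemma of the realisation). [folklore] -/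
theorem rootJ_lt (V : GaugeConfig 4 M SU3) (n₀ : ℕ) (hn : 1 ≤ n₀) (c : Edge 4 M) :
    rootJ V n₀ hn c < 3 :=
  (exists_small_root (V c) hn).choose_spec.choose_spec.1

/-- `rootX_pow_mul` (bookkeeping lemma of the realisation). [folklore] -/
theorem rootX_pow_mul (V : GaugeConfig 4 M SU3) (n₀ : ℕ) (hn : 1 ≤ n₀) (c : Edge 4 M) :
    rootX V n₀ hn c ^ n₀ * ζ ^ rootJ V n₀ hn c = V c := by
  rw [ζ_eq_scalarCenter]
  exact (exists_small_root (V c) hn).choose_spec.choose_spec.2.1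

/-- `norm_rootX_sub_one` (bookkeeping lemma of the realisation). [folklore] -/
theorem norm_rootX_sub_one (V : GaugeConfig 4 M SU3) (n₀ : ℕ) (hn : 1 ≤ n₀) (c : Edge 4 M) :
    ‖((rootX V n₀ hn c : SU3) : M3) - 1‖ ≤ 2 * π / n₀ :=
  (exists_small_root (V c) hn).choose_spec.choose_spec.2.2

/-- The dial code of the coarse edge `c`. [folklore] -/
def dialQ (V : GaugeConfig 4 M SU3) (n₀ : ℕ) (hn : 1 ≤ n₀) (w : ℕ) (c : Edge 4 M) : ℕ :=
  Nat.pair n₀ (rootJ V n₀ hn c + 3 * w)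

/-- The dial link value of the coarse edge `c`. [folklore] -/
def dialD (V : GaugeConfig 4 M SU3) (n₀ : ℕ) (hn : 1 ≤ n₀) (w : ℕ) (c : Edge 4 M) : SU3 :=
  dial (((dialQ V n₀ hn w c : ℝ) + 1)⁻¹)

/-- `decode_dialD` (bookkeeping lemma of the realisation). [folklore] -/
theorem decode_dialD (V : GaugeConfig 4 M SU3) (n₀ : ℕ) (hn : 1 ≤ n₀) (w : ℕ) (c : Edge 4 M) :
    decode (((dialD V n₀ hn w c : SU3) : M3).trace.re) = (n₀, rootJ V n₀ hn c) := by
  rw [dialD, re_trace_dial, decode_dial, dialQ, Nat.unpair_pair]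
  simp only [Nat.add_mul_mod_self_left, Nat.mod_eq_of_lt (rootJ_lt V n₀ hn c)]

/-- `norm_dialD_sub_one` (bookkeeping lemma of the realisation). [folklore] -/
theorem norm_dialD_sub_one (V : GaugeConfig 4 M SU3) (n₀ : ℕ) (hn : 1 ≤ n₀) (w : ℕ) (c : Edge 4 M) :
    ‖((dialD V n₀ hn w c : SU3) : M3) - 1‖ ≤ ((3 * w : ℝ) + 1)⁻¹ := by
  refine (norm_dial_sub_one_le _).trans ?_
  rw [abs_of_nonneg (by positivity)]
  have h : 3 * w ≤ dialQ V n₀ hn w c := (Nat.le_add_left _ _).trans (Nat.right_le_pair _ _)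
  have h' : (3 * w : ℝ) + 1 ≤ (dialQ V n₀ hn w c : ℝ) + 1 := by exact_mod_cast Nat.add_le_add_right h 1
  exact inv_anti₀ (by positivity) h'

/-! ### The modified links and the realisation -/

/-- The slot index in the `e₃` coordinate: `2 + i` for the `X`-plaquette, `6 + i` for the dial. [folklore] -/
def slot (i : Fin 4) (r : Bool) : ℕ := if r then 6 + i else 2 + i

/-- `slot_injective` (bookkeeping lemma of the realisation). [folklore] -/
theorem slot_injective {i i' : Fin 4} {r r' : Bool} (h : slot i r = slot i' r') : i = i' ∧ r = r' := by
  have hi := i.isLt; have hi' := i'.isLt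
  cases r <;> cases r' <;> simp only [slot, Bool.false_eq_true, ↓reduceIte] at h
  · exact ⟨Fin.ext (by omega), rfl⟩
  · omega
  · omega
  · exact ⟨Fin.ext (by omega), rfl⟩

/-- `two_le_slot` (bookkeeping lemma of the realisation). [folklore] -/
theorem two_le_slot (i : Fin 4) (r : Bool) : 2 ≤ slot i r ∧ slot i r ≤ 9 := by
  unfold slot; have := i.isLt; split_ifs <;> omega

/-- The modified link of the coarse edge `c` and role `r`: the private first link of its
`X`-plaquette (`r = false`) or dial plaquette (`r = true`). [folklore] -/
def modEdge (N : ℕ) (cr : Edge 4 M × Bool) : Edge 4 N :=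
  (anchor N (cr.1.1.shift cr.1.2) (oP (slot cr.1.2 cr.2)), 0)

/-- `modEdge_injective` (bookkeeping lemma of the realisation). [folklore] -/
theorem modEdge_injective [NeZero M] (hMb : M * b ≤ N) (hb : 20 ≤ b) : Function.Injective (modEdge (M := M) N) := by
  rintro ⟨⟨y, i⟩, r⟩ ⟨⟨y', i'⟩, r'⟩ h
  simp only [modEdge, Prod.mk.injEq, and_true] at h
  have hoP : ∀ t : ℕ, t ≤ 9 → ∀ c, 2 * |oP t c| < b := fun t ht c => by
    fin_cases c <;> simp [oP] <;> omega
  obtain ⟨hy, ho⟩ := anchor_inj hMb h (hoP _ (two_le_slot i r).2) (hoP _ (two_le_slot i' r').2)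
  have ht : slot i r = slot i' r' := by
    have := congrFun ho 3; simpa [oP] using this
  obtain ⟨rfl, rfl⟩ := slot_injective ht
  have hy' : y = y' := by
    simp only [Site.shift] at hy
    exact add_right_cancel hy
  rw [hy']

/-- The values carried by the modified links. [folklore] -/
def modVal (V : GaugeConfig 4 M SU3) (n₀ : ℕ) (hn : 1 ≤ n₀) (w : ℕ) (cr : Edge 4 M × Bool) : SU3 :=
  if cr.2 then dialD V n₀ hn w cr.1 else rootX V n₀ hn cr.1

/-- **The realisation**: `1` on every link except the modified ones. [folklore] -/
def realise (N : ℕ) (V : GaugeConfig 4 M SU3) (n₀ : ℕ) (hn : 1 ≤ n₀) (w : ℕ) : GaugeConfig 4 N SU3 :=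
  Function.extend (modEdge N) (modVal V n₀ hn w) fun _ => 1

/-- `realise_modEdge` (bookkeeping lemma of the realisation). [folklore] -/
theorem realise_modEdge [NeZero M] (hMb : M * b ≤ N) (hb : 20 ≤ b) (V : GaugeConfig 4 M SU3) (n₀ : ℕ)
    (hn : 1 ≤ n₀) (w : ℕ) (cr : Edge 4 M × Bool) :
    realise N V n₀ hn w (modEdge N cr) = modVal V n₀ hn w cr :=
  (modEdge_injective hMb hb).extend_apply _ _ cr

/-- `realise_of_not_mem` (bookkeeping lemma of the realisation). [folklore] -/
theorem realise_of_not_mem (V : GaugeConfig 4 M SU3) (n₀ : ℕ) (hn : 1 ≤ n₀) (w : ℕ) {e : Edge 4 N}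
    (he : ∀ cr : Edge 4 M × Bool, modEdge N cr ≠ e) : realise N V n₀ hn w e = 1 := by
  show Function.extend (modEdge N) (modVal V n₀ hn w) (fun _ => 1) e = 1
  exact Function.extend_apply' (f := modEdge N) (modVal V n₀ hn w) (fun _ => (1 : SU3)) e
    fun ⟨cr, hcr⟩ => he cr hcr

/-- Links of non-zero direction are not modified. [folklore] -/
theorem modEdge_ne_of_dir {e : Edge 4 N} (he : e.2 ≠ 0) (cr : Edge 4 M × Bool) : modEdge N cr ≠ e :=
  fun h => he (by rw [← h]; rfl)

/-- A link based at `anchor y o` with `o 0 = 0` or `o 1 ≠ 1` (small) is not modified. [folklore] -/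
theorem modEdge_ne_of_offset [NeZero M] (hMb : M * b ≤ N) (hb : 20 ≤ b) {y : Site 4 M} {o : Fin 4 → ℤ} {k : Fin 4}
    (ho : (o 0 ≠ 1 ∧ 2 * |o 0| < b) ∨ (o 1 ≠ 1 ∧ 2 * |o 1| < b)) (cr : Edge 4 M × Bool) :
    modEdge N cr ≠ (anchor N y o, k) := by
  intro h
  simp only [modEdge, Prod.mk.injEq] at h
  rcases ho with ⟨h0, hs⟩ | ⟨h1, hs⟩
  · have := (anchor_coord_inj hMb h.1 0 (by simp [oP]; omega) hs).2
    simp [oP] at this; exact h0 this.symm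
  · have := (anchor_coord_inj hMb h.1 1 (by simp [oP]; omega) hs).2
    simp [oP] at this; exact h1 this.symm

/-! ### `Bl (realise V) = V` -/

/-- The straight transport of the all-`1` configuration is `1`. [folklore] -/
theorem lineHolonomy_one (k : Fin 4) : ∀ (n : ℕ) (x : Site 4 N),
    lineHolonomy (fun _ : Edge 4 N => (1 : SU3)) k n x = 1
  | 0, _ => rfl
  | n + 1, x => by rw [lineHolonomy, lineHolonomy_one k n]; exact one_mul 1

section BlRealise

variable [NeZero M] (hMb : M * b ≤ N) (hb : 20 ≤ b) (V : GaugeConfig 4 M SU3) (n₀ : ℕ) (hn : 1 ≤ n₀) (w : ℕ)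
include hMb hb

/-- The realisation is `1` along every straight transport path beyond its first link. [folklore] -/
theorem realise_path (y : Site 4 M) (i : Fin 4) (s : ℕ) :
    realise N V n₀ hn w (anchor N y (Pi.single i (s : ℤ)), i) = 1 := by
  refine realise_of_not_mem V n₀ hn w fun cr => ?_
  by_cases hi : i = 0
  · subst hi
    refine modEdge_ne_of_offset hMb hb (Or.inr ⟨?_, ?_⟩) cr
    · simp
    · simp; omega
  · exact modEdge_ne_of_dir hi cr

/-- `lineHolonomy_realise` (bookkeeping lemma of the realisation). [folklore] -/
theorem lineHolonomy_realise (y : Site 4 M) (i : Fin 4) (n : ℕ) :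
    lineHolonomy (realise N V n₀ hn w) i n (cor N y) = 1 := by
  rw [cor_eq_anchor, lineHolonomy_congr (V := fun _ => (1 : SU3)) i n (anchor N y 0) fun s _ => ?_,
    lineHolonomy_one]
  rw [anchor_add_single, zero_add]
  exact realise_path hMb hb V n₀ hn w y i s

/-- `lassoTransport_realise` (bookkeeping lemma of the realisation). [folklore] -/
theorem lassoTransport_realise (y' : Site 4 M) (t : ℕ) :
    lassoTransport y' t (realise N V n₀ hn w) = 1 := by
  unfold lassoTransport
  have h0 : realise N V n₀ hn w (anchor N y' oA0, 2) = 1 :=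
    realise_of_not_mem V n₀ hn w fun cr => modEdge_ne_of_dir (by simp) cr
  have h1 : realise N V n₀ hn w (anchor N y' (oA1 t), 0) = 1 := by
    refine realise_of_not_mem V n₀ hn w fun cr => modEdge_ne_of_offset hMb hb (Or.inl ⟨?_, ?_⟩) cr
    · simp [oA1]
    · simp [oA1]; omega
  have h2 : realise N V n₀ hn w (anchor N y' (oA2 t), 1) = 1 :=
    realise_of_not_mem V n₀ hn w fun cr => modEdge_ne_of_dir (by simp) cr
  have h3 : lineHolonomy (realise N V n₀ hn w) 3 t (anchor N y' oA0) = 1 := by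
    rw [lineHolonomy_congr (V := fun _ => (1 : SU3)) 3 t (anchor N y' oA0) fun s _ => ?_, lineHolonomy_one]
    exact realise_of_not_mem V n₀ hn w fun cr => modEdge_ne_of_dir (by simp) cr
  rw [h0, h1, h2, h3]
  simp

/-- `plaquette_realise` (bookkeeping lemma of the realisation). [folklore] -/
theorem plaquette_realise (c : Edge 4 M) (r : Bool) :
    plaquetteHolonomy (realise N V n₀ hn w) (anchor N (c.1.shift c.2) (oP (slot c.2 r))) 0 1 =
      modVal V n₀ hn w (c, r) := by
  unfold plaquetteHolonomy
  rw [anchor_shift, anchor_shift]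
  have h1 : realise N V n₀ hn w (anchor N (c.1.shift c.2) (oP (slot c.2 r)), 0) = modVal V n₀ hn w (c, r) :=
    realise_modEdge hMb hb V n₀ hn w (c, r)
  have h2 : realise N V n₀ hn w (anchor N (c.1.shift c.2) (oP (slot c.2 r) + Pi.single 0 1), 1) = 1 :=
    realise_of_not_mem V n₀ hn w fun cr => modEdge_ne_of_dir (by simp) cr
  have h3 : realise N V n₀ hn w (anchor N (c.1.shift c.2) (oP (slot c.2 r) + Pi.single 1 1), 0) = 1 := by
    refine realise_of_not_mem V n₀ hn w fun cr => modEdge_ne_of_offset hMb hb (Or.inr ⟨?_, ?_⟩) cr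
    · simp [oP]
    · simp [oP]; omega
  have h4 : realise N V n₀ hn w (anchor N (c.1.shift c.2) (oP (slot c.2 r)), 1) = 1 :=
    realise_of_not_mem V n₀ hn w fun cr => modEdge_ne_of_dir (by simp) cr
  rw [h1, h2, h3, h4]
  simp

/-- `lasso_realise` (bookkeeping lemma of the realisation). [folklore] -/
theorem lasso_realise (c : Edge 4 M) (r : Bool) :
    lasso (c.1.shift c.2) (slot c.2 r) (realise N V n₀ hn w) = modVal V n₀ hn w (c, r) := by
  rw [lasso, lassoTransport_realise hMb hb, plaquette_realise hMb hb]
  simp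

/-- `blExp_realise` (bookkeeping lemma of the realisation). [folklore] -/
theorem blExp_realise (y : Site 4 M) (i : Fin 4) :
    blExp y i (realise N V n₀ hn w) = (n₀, rootJ V n₀ hn (y, i)) := by
  unfold blExp
  rw [show 6 + (i : ℕ) = slot i true from rfl, lasso_realise hMb hb V n₀ hn w (y, i) true]
  simp only [modVal, if_true]
  exact decode_dialD V n₀ hn w (y, i)

/-- **`Bl (realise V) = V`.** [folklore] -/
theorem bl_realise : bl (realise N V n₀ hn w) = V := by
  funext c
  obtain ⟨y, i⟩ := c
  change blEdge y i (realise N V n₀ hn w) = V (y, i)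
  unfold blEdge
  rw [lineHolonomy_realise hMb hb, blExp_realise hMb hb, show 2 + (i : ℕ) = slot i false from rfl,
    lasso_realise hMb hb V n₀ hn w (y, i) false, one_mul]
  simp only [modVal]
  exact rootX_pow_mul V n₀ hn (y, i)

/-- Every link of the realisation is within `max (2π/n₀) (1/(3w+1))` of `1`. [folklore] -/
theorem norm_realise_sub_one_le (e : Edge 4 N) :
    ‖((realise N V n₀ hn w e : SU3) : M3) - 1‖ ≤ max (2 * π / n₀) (((3 * w : ℝ)) + 1)⁻¹ := by
  by_cases he : ∃ cr : Edge 4 M × Bool, modEdge N cr = e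
  · obtain ⟨cr, rfl⟩ := he
    rw [realise_modEdge hMb hb]
    unfold modVal
    split_ifs
    · exact (norm_dialD_sub_one V n₀ hn w _).trans (le_max_right _ _)
    · exact (norm_rootX_sub_one V n₀ hn _).trans (le_max_left _ _)
  · rw [realise_of_not_mem V n₀ hn w fun cr h => he ⟨cr, h⟩]
    simp only [OneMemClass.coe_one, sub_self, norm_zero]
    exact le_max_of_le_right (by positivity)

end BlRealise

/-! ### The Wilson action of near-identity configurations -/

section Action

/-- `‖a b − 1‖ ≤ ‖a − 1‖ + ‖b − 1‖` for unitary `a`. [folklore] -/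
theorem norm_mul_sub_one_le {a : M3} (ha : a ∈ Matrix.unitaryGroup (Fin 3) ℂ) (bM : M3) :
    ‖a * bM - 1‖ ≤ ‖a - 1‖ + ‖bM - 1‖ := by
  letI : CStarAlgebra M3 := {}
  have h : a * bM - 1 = a * (bM - 1) + (a - 1) := by noncomm_ring
  rw [h]
  calc ‖a * (bM - 1) + (a - 1)‖ ≤ ‖a * (bM - 1)‖ + ‖a - 1‖ := norm_add_le _ _
    _ ≤ ‖a‖ * ‖bM - 1‖ + ‖a - 1‖ := by gcongr; exact norm_mul_le _ _
    _ = ‖bM - 1‖ + ‖a - 1‖ := by rw [CStarRing.norm_of_mem_unitary ha, one_mul]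
    _ = ‖a - 1‖ + ‖bM - 1‖ := add_comm _ _

/-- `‖a⋆ − 1‖ = ‖a − 1‖`. [folklore] -/
theorem norm_star_sub_one (a : M3) : ‖star a - 1‖ = ‖a - 1‖ := by
  letI : CStarAlgebra M3 := {}
  rw [show star a - 1 = star (a - 1) by rw [star_sub, star_one], norm_star]

/-- The holonomy of a plaquette whose four links are within `η` of `1` is within `4η` of `1`. [folklore] -/
theorem norm_plaquetteHolonomy_sub_one_le {η : ℝ} {U : GaugeConfig 4 N SU3}
    (hU : ∀ e, ‖((U e : SU3) : M3) - 1‖ ≤ η) (x : Site 4 N) (i j : Fin 4) :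
    ‖((plaquetteHolonomy U x i j : SU3) : M3) - 1‖ ≤ 4 * η := by
  have hu : ∀ g : SU3, (g : M3) ∈ Matrix.unitaryGroup (Fin 3) ℂ :=
    fun g => Matrix.specialUnitaryGroup_le_unitaryGroup g.2
  have hinv : ∀ g : SU3, ((g⁻¹ : SU3) : M3) = star (g : M3) := fun g => by
    rw [← Matrix.star_eq_inv]; rfl
  unfold plaquetteHolonomy
  rw [Submonoid.coe_mul, Submonoid.coe_mul, Submonoid.coe_mul, hinv, hinv]
  calc ‖(U (x, i) : M3) * (U (x.shift i, j) : M3) * star (U (x.shift j, i) : M3) * star (U (x, j) : M3) - 1‖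
      ≤ ‖(U (x, i) : M3) * (U (x.shift i, j) : M3) * star (U (x.shift j, i) : M3) - 1‖ + ‖star (U (x, j) : M3) - 1‖ :=
        norm_mul_sub_one_le (Submonoid.mul_mem _ (Submonoid.mul_mem _ (hu _) (hu _)) (Unitary.star_mem (hu _))) _
    _ ≤ ‖(U (x, i) : M3) * (U (x.shift i, j) : M3) - 1‖ + ‖star (U (x.shift j, i) : M3) - 1‖ +
          ‖star (U (x, j) : M3) - 1‖ := by
        gcongr; exact norm_mul_sub_one_le (Submonoid.mul_mem _ (hu _) (hu _)) _
    _ ≤ ‖(U (x, i) : M3) - 1‖ + ‖(U (x.shift i, j) : M3) - 1‖ + ‖star (U (x.shift j, i) : M3) - 1‖ +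
          ‖star (U (x, j) : M3) - 1‖ := by
        gcongr; exact norm_mul_sub_one_le (hu _) _
    _ ≤ η + η + η + η := by
        rw [norm_star_sub_one, norm_star_sub_one]
        gcongr <;> exact hU _
    _ = 4 * η := by ring

/-- **Wilson action of a near-identity configuration**: if every link is within `η` of `1` then
`S_W(U) ≤ 12 η · #plaquettes` (fundamental representation of `SU(3)`). [folklore] -/
theorem wilsonAction_le_of_norm_sub_one_le [NeZero N] {η : ℝ} {U : GaugeConfig 4 N SU3}
    (hU : ∀ e, ‖((U e : SU3) : M3) - 1‖ ≤ η) :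
    wilsonAction (fundamentalRep (Fin 3)) U ≤ 12 * η * Fintype.card (Plaquette 4 N) := by
  unfold wilsonAction
  calc ∑ p : Plaquette 4 N, (((3 : ℕ) : ℝ) - (fundamentalRep (Fin 3)
          (plaquetteHolonomy U p.1 p.2.1.1 p.2.1.2)).trace.re)
      ≤ ∑ _p : Plaquette 4 N, 12 * η := Finset.sum_le_sum fun p _ => by
        rw [fundamentalRep_apply, Nat.cast_ofNat]
        refine (three_sub_re_trace_le _).trans ?_
        have := norm_plaquetteHolonomy_sub_one_le hU p.1 p.2.1.1 p.2.1.2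
        linarith
    _ = 12 * η * Fintype.card (Plaquette 4 N) := by
        rw [Finset.sum_const, Finset.card_univ, nsmul_eq_mul]; ring

/-- The Wilson action of `SU(3)` configurations is non-negative. [folklore] -/
theorem wilsonAction_nonneg [NeZero N] (U : GaugeConfig 4 N SU3) :
    0 ≤ wilsonAction (fundamentalRep (Fin 3)) U := by
  letI : CStarAlgebra M3 := {}
  unfold wilsonAction
  refine Finset.sum_nonneg fun p _ => ?_
  rw [fundamentalRep_apply, Nat.cast_ofNat, sub_nonneg]
  set g : SU3 := plaquetteHolonomy U p.1 p.2.1.1 p.2.1.2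
  have h1 := norm_trace_le (g : M3)
  rw [CStarRing.norm_of_mem_unitary (Matrix.specialUnitaryGroup_le_unitaryGroup g.2), mul_one] at h1
  exact (re_le_norm _).trans h1

end Action

/-! ### The fibre infimum vanishes identically -/

/-- **(W2) Zero fibre infimum**: for EVERY coarse configuration `V`,
`⨅ {U : Bl U = V}, S_W(U) = 0` (`M b ≤ N`, `20 ≤ b`). [folklore] -/
theorem iInf_fibre_wilsonAction_eq_zero [NeZero N] [NeZero M] (hMb : M * b ≤ N) (hb : 20 ≤ b)
    (V : GaugeConfig 4 M SU3) :
    (⨅ U : {U : GaugeConfig 4 N SU3 // bl U = V}, wilsonAction (fundamentalRep (Fin 3)) U.1) = 0 := by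
  have hne : Nonempty {U : GaugeConfig 4 N SU3 // bl U = V} :=
    ⟨⟨realise N V 1 le_rfl 0, bl_realise hMb hb V 1 le_rfl 0⟩⟩
  have hbdd : BddBelow (Set.range fun U : {U : GaugeConfig 4 N SU3 // bl U = V} =>
      wilsonAction (fundamentalRep (Fin 3)) U.1) := ⟨0, by rintro _ ⟨U, rfl⟩; exact wilsonAction_nonneg _⟩
  refine le_antisymm (le_of_forall_pos_le_add fun δ hδ => ?_) (le_ciInf fun U => wilsonAction_nonneg _)
  rw [zero_add]
  -- choose the smallness
  set C : ℝ := 12 * (Fintype.card (Plaquette 4 N) : ℝ) + 1 with hC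
  have hCpos : 0 < C := by positivity
  set η : ℝ := δ / C with hη
  have hηpos : 0 < η := div_pos hδ hCpos
  obtain ⟨n₀, hn₀⟩ : ∃ n₀ : ℕ, 2 * π / η ≤ n₀ := exists_nat_ge _
  have hn₀1 : 1 ≤ n₀ := by
    have : (0 : ℝ) < n₀ := lt_of_lt_of_le (by positivity) hn₀
    exact_mod_cast Nat.one_le_iff_ne_zero.2 (by rintro rfl; simp at this)
  obtain ⟨w, hw⟩ : ∃ w : ℕ, η⁻¹ ≤ w := exists_nat_ge _
  have h1 : 2 * π / n₀ ≤ η := by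
    rw [div_le_iff₀ (by exact_mod_cast hn₀1)]
    calc 2 * π = 2 * π / η * η := by field_simp
      _ ≤ n₀ * η := by gcongr
      _ = η * n₀ := mul_comm _ _
  have h2 : ((3 * w : ℝ) + 1)⁻¹ ≤ η := by
    have hw' : η⁻¹ ≤ 3 * w + 1 := hw.trans (by linarith [(Nat.cast_nonneg w : (0 : ℝ) ≤ w)])
    calc ((3 * w : ℝ) + 1)⁻¹ ≤ (η⁻¹)⁻¹ := inv_anti₀ (by positivity) hw'
      _ = η := inv_inv η
  have hlinks : ∀ e, ‖((realise N V n₀ hn₀1 w e : SU3) : M3) - 1‖ ≤ η := fun e =>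
    (norm_realise_sub_one_le hMb hb V n₀ hn₀1 w e).trans (max_le h1 h2)
  calc (⨅ U : {U : GaugeConfig 4 N SU3 // bl U = V}, wilsonAction (fundamentalRep (Fin 3)) U.1)
      ≤ wilsonAction (fundamentalRep (Fin 3)) (realise N V n₀ hn₀1 w) :=
        ciInf_le hbdd ⟨realise N V n₀ hn₀1 w, bl_realise hMb hb V n₀ hn₀1 w⟩
    _ ≤ 12 * η * Fintype.card (Plaquette 4 N) := wilsonAction_le_of_norm_sub_one_le hlinks
    _ ≤ δ := by
        rw [hη]
        have h12 : 12 * (Fintype.card (Plaquette 4 N) : ℝ) ≤ C := by rw [hC]; linarith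
        calc 12 * (δ / C) * Fintype.card (Plaquette 4 N) = δ * (12 * Fintype.card (Plaquette 4 N) / C) := by ring
          _ ≤ δ * 1 := by gcongr; rwa [div_le_one hCpos]
          _ = δ := mul_one δ

end Summit.QuantumFields.QCD.Theorems.RobustYangMillsRG.Negative

end
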